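import Literature.Probability.Percolation.InterfaceScalingLimitDiscretised
import Literature.Probability.LatticeModels.MedialInterfaceMeasurability
import HarnessLib

/-!
# Measurability of the bond-percolation interface on `δℤ²` (discharge of `aemeasurable_bondInterface`)

Companion (theorems only) to `Literature.Probability.Percolation.InterfaceScalingLimit` /
`InterfaceScalingLimitDiscretised`, parallel to `InterfaceScalingLimitMeasurability` (the
triangular case). The bond interface `bondInterfaceIn D E ω = CurveClass.mk (orientCurve D
(medialExplorationCurve E ω))` — and its canonical-data case `bondInterface D δ` — is a function of
the medial exploration `medialExploration E ω`, hence measurable by the factorisation principle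
`Literature.Probability.LatticeModels.measurable_of_medialExploration`
(`LatticeModels/MedialInterfaceMeasurability.lean`), for every `D`, `E`, `δ`: no admissibility,
boundedness or `δ > 0` hypothesis is needed, and the laws
`(bondPercolation (zdGraph 2) half).map (bondInterface D δ)` are genuine push-forwards.
(Aizenman–Burchard, Duke Math. J. 99 (1999), §2.1; Smirnov 2001, §2.)

Contents: `measurable_bondInterfaceIn`, `measurable_bondInterface`, and the discharge
`aemeasurable_bondInterface_holds` of the named fact `aemeasurable_bondInterface`.

## References

* M. Aizenman, A. Burchard, *Hölder regularity and dimension bounds for random curves*, Duke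
  Math. J. 99 (1999), 419–453, §2.1.
* S. Smirnov, *Critical percolation in the plane*, C. R. Acad. Sci. Paris 333 (2001), §2.
-/

noncomputable section

namespace Literature.Probability.Percolation

open _root_.MeasureTheory LatticeModels

section Measurability

/-- The bond interface `bondInterfaceIn D E : BondConfig (Site 2) → CurveClass ℂ` of arbitrary
discrete Dobrushin data `E` is (Borel) measurable, for every Dobrushin domain `D`: it is a function
of `medialExploration E ω`. (Aizenman–Burchard 1999, §2.1; Smirnov 2001, §2.) [cite: AizenmanBurchard1999, §2.1] -/
theorem measurable_bondInterfaceIn (D : RandomPlanarGeometry.DobrushinDomain) (E : DiscreteDobrushin) :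
    Measurable (bondInterfaceIn D E) :=
  measurable_of_medialExploration E fun ω ω' h => by
    rw [bondInterfaceIn_apply, bondInterfaceIn_apply, medialExplorationCurve_congr h]

/-- The bond interface `bondInterface D δ` of the canonical data `dobrushinData D δ` is (Borel)
measurable, for every Dobrushin domain `D` and every real `δ`.
(Aizenman–Burchard 1999, §2.1; Smirnov 2001, §2.) [cite: AizenmanBurchard1999, §2.1] -/
theorem measurable_bondInterface (D : RandomPlanarGeometry.DobrushinDomain) (δ : ℝ) :
    Measurable (bondInterface D δ) :=
  measurable_of_medialExploration (dobrushinData D δ) fun ω ω' h => by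
    rw [bondInterface_apply, bondInterface_apply, medialExplorationCurve_congr h]

/-- **Discharge of `aemeasurable_bondInterface`** (measurability half of the bond-`ℤ²` interface
set-up): the bond-percolation interface on `δℤ²` is a.e.-measurable under critical bond
percolation — in fact measurable (`measurable_bondInterface`), under any measure.
(Aizenman–Burchard, Duke Math. J. 99 (1999), §2.1: interface laws as Borel probability measures on
the space of curves; Smirnov 2001, §2.) [cite: AizenmanBurchard1999, §2.1] -/
theorem aemeasurable_bondInterface_holds : aemeasurable_bondInterface :=
  fun D δ => (measurable_bondInterface D δ).aemeasurable

end Measurability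

end Literature.Probability.Percolation

end
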